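import Literature.MathematicalPhysics.KineticTheory.ReyBelletThomas2002Proofs
import HarnessLib

/-!
# Rey-Bellet–Thomas 2002: under H1 the energy `G` has compact sublevel sets

Topic `Literature/MathematicalPhysics/KineticTheory` (trunk T-KINETIC). Provefact unit for the
named fact `ReyBelletThomas2002_thm21` (`ReyBelletThomas2002.lean`). A small PROVED consequence of
hypothesis **H1** (`RBGrowth`, growth at infinity of the one-variable potentials: `W(sx)/s^k → a|x|^k`
with `a > 0`) used throughout the printed proof ("`V(q)` … grows at infinity like `‖q‖^k`", so the
energy `G(p,q,r) = r²/2 + H(p,q)` is a confining Lyapunov function; e.g. RBT §3.1, compactness of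
the energy surfaces, and §5, `W = e^{θG}` in Theorem 5.1):

* `RBGrowth.exists_forall_le_of_le_abs` — a potential satisfying H1 with `k ≥ 1` is coercive:
  for every `M` there is `ρ` with `W(y) ≥ M` whenever `|y| ≥ ρ`;
* `RBGrowth.exists_forall_le` — it is bounded below;
* `OscillatorChain.isCompact_setOf_rbEnergy_le` — for a chain whose pinning potential `U` and
  coupling potential `V` satisfy H1 (exponents `≥ 1`), every sublevel set `{G ≤ E}` of the energy
  on the extended phase space `RBPhaseSpace N` is compact (the hypothesis `hcpt` of
  `ReyBelletThomas2002Assembly.lean`).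

## References

* L. Rey-Bellet, L. E. Thomas, Comm. Math. Phys. **225** (2002) 305–329, §1 hypothesis H1, §2
  (the energy `G`).
-/

noncomputable section

open Filter Set Topology
open scoped ContDiff

namespace Literature.MathematicalPhysics.KineticTheory.HeatConduction

variable {N : ℕ}

namespace RBGrowth

variable {W : ℝ → ℝ} {k : ℝ}

/-- A potential satisfying H1 is continuous. [folklore] -/
theorem continuous (h : RBGrowth W k) : Continuous W := h.1.continuous

/-- **Coercivity from H1**: if `W(sx)/s^k → a|x|^k` (`a > 0`) for `x = ±1` and `k ≥ 1`, then for
every `M` there is `ρ` with `M ≤ W(y)` for `|y| ≥ ρ`. [cite: ReyBelletThomas2002, §1 H1] -/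
theorem exists_forall_le_of_le_abs (h : RBGrowth W k) (hk : 1 ≤ k) (M : ℝ) :
    ∃ ρ : ℝ, 0 ≤ ρ ∧ ∀ y : ℝ, ρ ≤ |y| → M ≤ W y := by
  obtain ⟨_, a, ha, hlim, -, -⟩ := h
  -- along `x = 1` and `x = -1`, eventually `W(±s) ≥ (a/2) s^k ≥ (a/2) s`
  have hev : ∀ x : ℝ, |x| = 1 → ∀ᶠ s in atTop, M ≤ W (s * x) := by
    intro x hx
    have hl : Tendsto (fun s : ℝ => W (s * x) / s ^ k) atTop (𝓝 a) := by
      simpa [hx] using hlim x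
    have h1 : ∀ᶠ s : ℝ in atTop, a / 2 < W (s * x) / s ^ k :=
      hl.eventually (lt_mem_nhds (by linarith))
    have h2 : ∀ᶠ s : ℝ in atTop, 2 * M / a ≤ s := eventually_ge_atTop _
    have h3 : ∀ᶠ s : ℝ in atTop, (1 : ℝ) ≤ s := eventually_ge_atTop _
    filter_upwards [h1, h2, h3] with s hs1 hs2 hs3
    have hs0 : 0 < s := by linarith
    have hsk : s ≤ s ^ k := by
      calc s = s ^ (1 : ℝ) := (Real.rpow_one s).symm
        _ ≤ s ^ k := Real.rpow_le_rpow_of_exponent_le hs3 hk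
    have hpos : 0 < s ^ k := Real.rpow_pos_of_pos hs0 k
    rw [lt_div_iff₀ hpos] at hs1
    have hM : M ≤ a / 2 * s := by
      rw [div_le_iff₀ ha] at hs2
      linarith
    nlinarith
  obtain ⟨ρ₁, hρ₁⟩ := eventually_atTop.1 (hev 1 (by simp))
  obtain ⟨ρ₂, hρ₂⟩ := eventually_atTop.1 (hev (-1) (by simp))
  refine ⟨max (max ρ₁ ρ₂) 0, le_max_right _ _, fun y hy => ?_⟩
  have hy1 : ρ₁ ≤ |y| := ((le_max_left _ _).trans (le_max_left _ _)).trans hy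
  have hy2 : ρ₂ ≤ |y| := ((le_max_right _ _).trans (le_max_left _ _)).trans hy
  rcases le_total 0 y with h0 | h0
  · have := hρ₁ |y| hy1
    rwa [mul_one, abs_of_nonneg h0] at this
  · have := hρ₂ |y| hy2
    rwa [mul_neg, mul_one, abs_of_nonpos h0, neg_neg] at this

/-- **A potential satisfying H1 (`k ≥ 1`) is bounded below.** [folklore] -/
theorem exists_forall_le (h : RBGrowth W k) (hk : 1 ≤ k) : ∃ m : ℝ, ∀ y : ℝ, m ≤ W y := by
  obtain ⟨ρ, -, hρ⟩ := h.exists_forall_le_of_le_abs hk 0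
  have hc : IsCompact (Metric.closedBall (0 : ℝ) ρ) := isCompact_closedBall 0 ρ
  obtain ⟨C, hC⟩ := hc.bddBelow_image h.continuous.continuousOn
  refine ⟨min C 0, fun y => ?_⟩
  by_cases hy : |y| ≤ ρ
  · have hmem : W y ∈ W '' Metric.closedBall (0 : ℝ) ρ :=
      ⟨y, by simpa [Metric.mem_closedBall, Real.dist_eq] using hy, rfl⟩
    exact (min_le_left _ _).trans (hC hmem)
  · exact (min_le_right _ _).trans (hρ y (le_of_lt (not_le.1 hy)))

end RBGrowth

namespace OscillatorChain

variable (P : OscillatorChain)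

/-- Lower bound for the Hamiltonian in terms of one momentum and one position: if `U ≥ m_U`
and `V ≥ m_V` with `m_U, m_V ≤ 0`, then for every site `i`,
`p_i²/2 + U(q_i) + N m_U + N² m_V ≤ H(q,p)`. [folklore] -/
theorem sq_add_U_le_hamiltonian {m_U m_V : ℝ} (hmU : m_U ≤ 0) (hmV : m_V ≤ 0)
    (hU : ∀ y, m_U ≤ P.U y) (hV : ∀ y, m_V ≤ P.V y) (N : ℕ) (x : PhaseSpace N) (i : Fin N) :
    x.2 i ^ 2 / 2 + P.U (x.1 i) + N * m_U + N ^ 2 * m_V ≤ P.hamiltonian N x := by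
  unfold hamiltonian
  have h1 : x.2 i ^ 2 / 2 + P.U (x.1 i) + N * m_U ≤ ∑ j, (x.2 j ^ 2 / 2 + P.U (x.1 j)) := by
    rw [← Finset.add_sum_erase _ _ (Finset.mem_univ i)]
    have h2 : ((Finset.univ.erase i).card : ℝ) * m_U ≤
        ∑ j ∈ Finset.univ.erase i, (x.2 j ^ 2 / 2 + P.U (x.1 j)) := by
      have := Finset.card_nsmul_le_sum (Finset.univ.erase i)
        (fun j => x.2 j ^ 2 / 2 + P.U (x.1 j)) m_U
        (fun j _ => by nlinarith [hU (x.1 j), sq_nonneg (x.2 j)])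
      rwa [nsmul_eq_mul] at this
    have h3 : (N : ℝ) * m_U ≤ ((Finset.univ.erase i).card : ℝ) * m_U := by
      refine mul_le_mul_of_nonpos_right ?_ hmU
      exact_mod_cast (Finset.card_le_univ _).trans (by simp)
    linarith
  have h4 : (N : ℝ) ^ 2 * m_V ≤
      ∑ i' : Fin N, ∑ j : Fin N, (if j.val = i'.val + 1 then P.V (x.1 j - x.1 i') else 0) := by
    have h5 : ∀ i' j : Fin N, m_V ≤ (if j.val = i'.val + 1 then P.V (x.1 j - x.1 i') else 0) := by
      intro i' j
      split_ifs
      · exact hV _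
      · exact hmV
    calc (N : ℝ) ^ 2 * m_V = ∑ _i' : Fin N, ∑ _j : Fin N, m_V := by
          simp [Finset.sum_const, Finset.card_univ, Fintype.card_fin]; ring
      _ ≤ _ := Finset.sum_le_sum fun i' _ => Finset.sum_le_sum fun j _ => h5 i' j
  linarith

/-- **Under H1 the energy `G = r²/2 + H` has compact sublevel sets** (pinning `U` and coupling
`V` satisfying `RBGrowth` with exponents `≥ 1`; `N` arbitrary): every coordinate of a point of
`{G ≤ E}` is bounded — the momenta and reservoir variables by `H ≥ p_i²/2 + const`,
`G ≥ r_b²/2 + const`, the positions by the coercivity of `U` — and the set is closed.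
[cite: ReyBelletThomas2002, §1 H1] -/
theorem isCompact_setOf_rbEnergy_le {k₁ k₂ : ℝ} (hU : RBGrowth P.U k₁) (hV : RBGrowth P.V k₂)
    (hk₁ : 1 ≤ k₁) (hk₂ : 1 ≤ k₂) (N : ℕ) (E : ℝ) :
    IsCompact {x : RBPhaseSpace N | P.rbEnergy N x ≤ E} := by
  obtain ⟨mU₀, hmU₀⟩ := hU.exists_forall_le hk₁
  obtain ⟨mV₀, hmV₀⟩ := hV.exists_forall_le hk₂
  set m_U := min mU₀ 0 with hmUdef
  set m_V := min mV₀ 0 with hmVdef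
  have hmU : m_U ≤ 0 := min_le_right _ _
  have hmV : m_V ≤ 0 := min_le_right _ _
  have hUb : ∀ y, m_U ≤ P.U y := fun y => (min_le_left _ _).trans (hmU₀ y)
  have hVb : ∀ y, m_V ≤ P.V y := fun y => (min_le_left _ _).trans (hmV₀ y)
  -- the constant `c₀ = N m_U + N² m_V ≤ H - p_i²/2 - U(q_i)`
  set c₀ : ℝ := N * m_U + N ^ 2 * m_V with hc₀
  -- bounds: `p_i², r² ≤ 2 (E - c₀ - m_U)`, `U(q_i) ≤ E - c₀`
  set B : ℝ := Real.sqrt (2 * max (E - c₀ - m_U) 0) with hBdef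
  obtain ⟨ρ, hρ0, hρ⟩ := hU.exists_forall_le_of_le_abs hk₁ (E - c₀ + 1)
  -- the compact box
  set K : Set (RBPhaseSpace N) :=
    ((Set.univ.pi fun _ : Fin N => Icc (-ρ) ρ) ×ˢ (Set.univ.pi fun _ : Fin N => Icc (-B) B)) ×ˢ
      (Icc (-B) B ×ˢ Icc (-B) B) with hK
  have hKc : IsCompact K :=
    ((isCompact_univ_pi fun _ => isCompact_Icc).prod (isCompact_univ_pi fun _ => isCompact_Icc)).prod
      (isCompact_Icc.prod isCompact_Icc)
  have hclosed : IsClosed {x : RBPhaseSpace N | P.rbEnergy N x ≤ E} :=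
    isClosed_le (P.continuous_rbEnergy hU.continuous hV.continuous N) continuous_const
  refine hKc.of_isClosed_subset hclosed fun x hx => ?_
  rw [mem_setOf_eq, rbEnergy_apply] at hx
  have hH : ∀ i : Fin N, x.1.2 i ^ 2 / 2 + P.U (x.1.1 i) + c₀ ≤ P.hamiltonian N x.1 := fun i => by
    have := P.sq_add_U_le_hamiltonian hmU hmV hUb hVb N x.1 i
    rw [hc₀]; linarith
  have hr2 : 0 ≤ x.2.1 ^ 2 + x.2.2 ^ 2 := by positivity
  -- `H ≥ N m_U + c₀'`-type global lower bound: `H ≥ c₀ + m_U` (from any site, or directly if `N = 0`)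
  have hHlow : c₀ + m_U ≤ P.hamiltonian N x.1 := by
    rcases Nat.eq_zero_or_pos N with hN | hN
    · subst hN
      simp only [hc₀, Nat.cast_zero, zero_mul, zero_pow (two_ne_zero), zero_add]
      unfold hamiltonian
      simp [hmU]
    · have h := hH ⟨0, hN⟩
      nlinarith [hUb (x.1.1 ⟨0, hN⟩), sq_nonneg (x.1.2 ⟨0, hN⟩)]
  have hsq_le : ∀ s : ℝ, s ^ 2 ≤ 2 * max (E - c₀ - m_U) 0 → s ∈ Icc (-B) B := by
    intro s hs
    have h := Real.abs_le_sqrt hs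
    rw [← hBdef] at h
    exact ⟨by linarith [(abs_le.1 h).1], (abs_le.1 h).2⟩
  simp only [hK, mem_prod, mem_univ_pi]
  refine ⟨⟨fun i => ?_, fun i => ?_⟩, ?_, ?_⟩
  · -- positions: `U(q_i) ≤ E - c₀ < E - c₀ + 1`, so `|q_i| < ρ`
    have hUq : P.U (x.1.1 i) ≤ E - c₀ := by nlinarith [hH i, sq_nonneg (x.1.2 i)]
    have habs : |x.1.1 i| ≤ ρ := by
      by_contra hlt
      have := hρ (x.1.1 i) (le_of_lt (not_le.1 hlt))
      linarith
    exact ⟨by linarith [(abs_le.1 habs).1], (abs_le.1 habs).2⟩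
  · -- momenta
    refine hsq_le _ ?_
    have h1 : x.1.2 i ^ 2 ≤ 2 * (E - c₀ - m_U) := by nlinarith [hH i, hUb (x.1.1 i)]
    exact h1.trans (by nlinarith [le_max_left (E - c₀ - m_U) 0])
  · -- left reservoir
    refine hsq_le _ ?_
    have h1 : x.2.1 ^ 2 ≤ 2 * (E - c₀ - m_U) := by nlinarith [sq_nonneg x.2.2]
    exact h1.trans (by nlinarith [le_max_left (E - c₀ - m_U) 0])
  · -- right reservoir
    refine hsq_le _ ?_
    have h1 : x.2.2 ^ 2 ≤ 2 * (E - c₀ - m_U) := by nlinarith [sq_nonneg x.2.1]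
    exact h1.trans (by nlinarith [le_max_left (E - c₀ - m_U) 0])

end OscillatorChain

end Literature.MathematicalPhysics.KineticTheory.HeatConduction
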